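/-
Copyright (c) 2026 the pub-hodgecm-mathlib formalisation cell (harness21).  Prover seat hodgecm-mathlib-A-p19 (g27), 2026-09-01.  Road «S3-tree»∕«S3-ram» (LEAD F0P3a-plan (g12)
T11-41∕T11-52; owner p06 (g15); consumer A-p12 (g23) (α₂) STUB A₂), row (e2) «P-2-ram», organ «[T2-b]-ram CORE» — the RAMIFIED-BASE twin of ★ `RationalGoodVectorParity` (B-p14 (g37)):
at a tame-ramified base with an UNRAMIFIED eigen-field, a RATIONAL good vector exists iff ONE norm equation over the eigen-field is solvable (certificate `F0/P3/A-p19/g27/cert/CERT-T2b-ram`).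
-/
import Literature.NumberTheory.Automorphic.RationalGoodVectorParity     -- ★ [T2-b] inert core p846562 (B-p14 (g37)): `map_symmCriterion_zero_eq`, `map_symmCriterion_one_eq`; brings ★ O8a-∃ p845516 `criterion_eq_normSymm_mul`, `symmFactor_mem_span_pow`, `symmFactor_units`, `isUnit_normSymm_of_criterion`, `cayleyQuotient_skew`
import Literature.NumberTheory.Automorphic.SplitTorusOrderCyclicLattices  -- ★ O7 (F0P3b-p01 (g11)): `apply_mem_of_mem_span_pow`
import HarnessLib

/-!
# The good type-(2) class at a TAME-RAMIFIED base: a rational good vector exists iff the eigen-field norm equation `b·σ(b)·c′₁ = 1` is solvable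
# (Rogawski 1990 Lemma 4.9.3; Jacobowitz 1962 §5, §7, §8)

Topic `NumberTheory/Automorphic`; namespace `Literature.NumberTheory.Automorphic.SymmetricEigenframe`.  THEOREMS ONLY (no definition, no instance, no notation, no named fact, no
`sorry`); generic: ONE field `K`, a subring `O`, TWO commuting ring endomorphisms `σ`, `ι`; §3–§4 also `[Valued K ℤᵐ⁰]`.  Cell `pub/hodgecm-mathlib` (D-0151), crux H413 =
`stmt-HodgeConjecture-24833`; road «S3-tree», seeding wave «S3-ram» (tame-ramified non-split `v ∤ 2`), row (e2) «P-2-ram» = the type-(2) share of the level-one clause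
`stub_levelOneRowsRam`; organ **«[T2-b]-ram CORE»** (this seat; consumer: the R2²-ram one-place row of A-p12 (g23)'s STUB A₂).  HONEST LABEL: HC_CM is proved only modulo the 2
remaining named inputs (hLiu418 24832, h413 24833) until rung 0 closes; elementary algebra over ★ O8a-∃, asserts nothing printed.

THE DICTIONARY (★ `RationalGoodVectorParity` with the roles of the two quadratic extensions SWAPPED; certificate memo `F0/P3/A-p19/g27/cert/CERT-T2b-ram.A-p19g27.md` 5cd795ce7793b3e7).
`K` = the eigen-field `M = L_w(θ)` of a type-(2) class at a TAME-RAMIFIED CM place `w ∣ v` (`θ² = ε` a non-square unit: `M ∕ L_w` UNRAMIFIED — F0P2-p02 (g12) ★ `LocalIrreducibleTorusDiscriminantRamified`);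
`σ` = the CM involution `σ̃` of `M` (type A `σ̃θ = θ`, type B `σ̃θ = −θ`), `ι` = the `L_w`-involution (`ιθ = −θ`, `Fix ι = L_w`), `σι = ισ`; `O = 𝒪_M`; `γ = (u, λ, ιλ)` the eigenvalues
(norm one, RESIDUALLY EQUAL — deepness — with `1 + γᵢ ∈ O^×`), `d = (d₀, d₁, ιd₁)` the diagonal Gram values of the symmetric eigenframe.  NO SKEW UNIT EXISTS at a ramified base (`σ̄ = id`), and none
is needed: with THREE nodes the product `s′ᵢ := ∏_{j≠i} (γᵢ − γⱼ)∕((1+γᵢ)(1+γⱼ))` of TWO skew Cayley quotients (★ `cayleyQuotient_skew`) is `σ`-FIXED (§1), so ★ O8a-∃ runs at `δ := 1`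
with the `σ`-fixed criterion scalars `c′ᵢ := dᵢ·s′ᵢ` (`c′₀` is `ι`-fixed, `c′₂ = ι c′₁`).  A vector `a ∈ K³` is RATIONAL if `ι a₀ = a₀`, `a₂ = ι a₁`, and GOOD in ★ O7∕O8a's token:
`T(a) := (dᵢ·aᵢσ(aᵢ)·∏_{j≠i}(γᵢ − γⱼ))ᵢ ∈ span_O{γ^j}` with unit components.
RAMIFIED NORM DICTIONARIES (hypotheses, discharged by the carrier at the CM place): a `σ`- and `ι`-fixed unit `η₀ ∈ O^×` which is a `σ`-norm (`e σe = η₀`: the non-square residue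
constant of `L⁺_v` is a norm from `M` to `M^σ̃` in both torus types); (nE′) every non-zero `σ`- and `ι`-fixed `c` (an element of `L⁺_v`) has a RATIONAL `a` with `aσ(a)c ∈ {1, η₀}`
(`L⁺_v^× = N(L_w^×) ⊔ η₀·N(L_w^×)`, ★ `RamifiedPlaceUnitNorms`); (nK′) every `σ`-fixed unit of `O` congruent to a `σ`- and `ι`-fixed element modulo `𝔪` is a `σ`-norm (type B: `M ∕ M^σ̃`
unramified, all units are norms; type A: `M ∕ M^σ̃` tame-ramified and the residue lies in `𝓀_v ⊂ (𝓀_{M^σ̃})²`).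

THE RESULT.  §1 `s′ᵢ` is `σ`-fixed; the `δ := 1` readings of the ★ symmetrisation.  §2 (⟸) if `bσ(b)c′₁ = 1` is solvable then a rational GOOD vector exists: choose the constant
`κ ∈ {1, η₀}` with `a₀σ(a₀)c′₀ = κ` rational ((nE′)), `a₁ := b·e_κ` (`e_κσ(e_κ) = κ`), `a₂ := ιa₁`; then `T(a) = κ·λ′ ∈ R^×` (★ `symmFactor_mem_span_pow`∕`_units`) — the `d₀`-coordinate
NEVER obstructs at a ramified base (contrast ★ inert core §2, where both coordinates obstruct and the frame parity ties them).  §3 (⟹) a rational GOOD `a` gives units `vᵢ := aᵢσ(aᵢ)c′ᵢ ∈ O^×`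
(★ `isUnit_normSymm_of_criterion`) with `v₁ ≡ v₀ (mod 𝔪)` (all nodes residually equal ⇒ the components of any element of `R` are residually equal), `v₀` is `σ`- and `ι`-fixed, so (nK′)
makes `v₁` a `σ`-norm and `b := a₁∕e` solves the equation.  §4 **`exists_rational_good_iff_exists_norm_ramifiedBase`: (∃ rational GOOD `a`) ↔ (∃ b, bσ(b)c′₁ = 1)** — type-uniform; the
evaluation of the right side (type A: `χ_{M∕K′}(c′₁) = Leg(−ε̄·C₀)·ψ(d₁)`; type B: parity of `ord d₁ + n∕2 + N`) and the frame-link class identity converting `d₁` into the κ-reading on `d₀` are the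
one-place sequel (certified law: GOOD ⟺ `χ_{E∕F}(d₀·det h) = Leg(res(χ₂(u)∕(−ϖ_F)^{n∕2}))`, i.e. `κ_good = χ(det h)·μ_w((u−λ)(u−ιλ))`).

* §1 `prod_cayley_mul_one`, `symmProd_one_fixed`, `criterion_symm_sigma_fixed`.
* §2 `exists_good_of_norm_solutions_const` (★ O8a-∃ with a common unit constant), **`exists_rational_good_of_exists_norm_ramifiedBase`**.
* §3 `valuation_sub_lt_one_of_mem_span_pow` (components of `R` are residually equal), `valuation_symmFactor_sub_lt_one`, **`exists_norm_of_rational_good_ramifiedBase`**.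
* §4 **`exists_rational_good_iff_exists_norm_ramifiedBase`**.

## References
* [Rogawski1990] J. D. Rogawski, *Automorphic Representations of Unitary Groups in Three Variables* (1990), §4.9 Lemma 4.9.3 p. 56, Prop. 4.9.1 p. 55, p. 59 (the `μ`-factor).
* [Jacobowitz1962] R. Jacobowitz, *Hermitian forms over local fields*, Amer. J. Math. 84 (1962), §4, §5, §7 Thm. 7.1, §8 (ramified non-dyadic).
* [SerreLocalFields1979] J.-P. Serre, *Local Fields*, GTM 67 (1979), Ch. V §2 Prop. 3, Ch. V §3 Cor. 2 (norm groups of unramified ∕ tamely ramified quadratic extensions).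
* [LanglandsShelstad1987] R. P. Langlands, D. Shelstad, *On the definition of transfer factors*, Math. Ann. 278 (1987), §1.3–1.4.
-/

set_option autoImplicit false

open Finset
open scoped WithZero

namespace Literature.NumberTheory.Automorphic.SymmetricEigenframe

open Literature.NumberTheory.Automorphic

variable {K : Type*} [Field K]

/-! ## §1 Three nodes: the `δ := 1` symmetrisation is `σ`-fixed without a skew unit -/

/-- `∏_{j ≠ 0} f j = f 1 · f 2` on `Fin 3`. [folklore] -/
private theorem prod_erase_zero_three' {M : Type*} [CommMonoid M] (f : Fin 3 → M) : ∏ j ∈ univ.erase (0 : Fin 3), f j = f 1 * f 2 := by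
  rw [show univ.erase (0 : Fin 3) = {1, 2} by decide, Finset.prod_pair (by decide)]

/-- `∏_{j ≠ 1} f j = f 0 · f 2` on `Fin 3`. [folklore] -/
private theorem prod_erase_one_three' {M : Type*} [CommMonoid M] (f : Fin 3 → M) : ∏ j ∈ univ.erase (1 : Fin 3), f j = f 0 * f 2 := by
  rw [show univ.erase (1 : Fin 3) = {0, 2} by decide, Finset.prod_pair (by decide)]

/-- `∏_{j ≠ 2} f j = f 0 · f 1` on `Fin 3`. [folklore] -/
private theorem prod_erase_two_three' {M : Type*} [CommMonoid M] (f : Fin 3 → M) : ∏ j ∈ univ.erase (2 : Fin 3), f j = f 0 * f 1 := by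
  rw [show univ.erase (2 : Fin 3) = {0, 1} by decide, Finset.prod_pair (by decide)]

/-- The `δ := 1` reading of the ★ O8a symmetrised product: `∏_{j≠i} (γᵢ − γⱼ)∕((1+γᵢ)(1+γⱼ)·1) = ∏_{j≠i} (γᵢ − γⱼ)∕((1+γᵢ)(1+γⱼ))`. [cite: Jacobowitz1962, §4] -/
theorem prod_cayley_mul_one {n : ℕ} (γ : Fin n → K) (i : Fin n) :
    ∏ j ∈ univ.erase i, (γ i - γ j) / ((1 + γ i) * (1 + γ j) * (1 : K)) = ∏ j ∈ univ.erase i, (γ i - γ j) / ((1 + γ i) * (1 + γ j)) :=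
  Finset.prod_congr rfl fun j _ => by rw [mul_one]

/-- **`s′ᵢ := ∏_{j≠i} (γᵢ − γⱼ)∕((1+γᵢ)(1+γⱼ))` IS `σ`-FIXED FOR THREE NORM-ONE NODES** — a product of TWO skew Cayley quotients (★ `cayleyQuotient_skew`); no skew unit is needed
(at a tame-ramified base none exists). [cite: Jacobowitz1962, §8] [cite: SerreLocalFields1979, Ch. V §3] -/
theorem symmProd_one_fixed (σ : K →+* K) {γ : Fin 3 → K} (hσγ : ∀ i, σ (γ i) = (γ i)⁻¹) (hγne : ∀ i, γ i ≠ 0) (i : Fin 3) :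
    σ (∏ j ∈ univ.erase i, (γ i - γ j) / ((1 + γ i) * (1 + γ j))) = ∏ j ∈ univ.erase i, (γ i - γ j) / ((1 + γ i) * (1 + γ j)) := by
  have hsk := cayleyQuotient_skew σ hσγ hγne
  obtain rfl | rfl | rfl : i = 0 ∨ i = 1 ∨ i = 2 := by fin_cases i <;> simp
  · rw [prod_erase_zero_three', map_mul, hsk, hsk, neg_mul_neg]
  · rw [prod_erase_one_three', map_mul, hsk, hsk, neg_mul_neg]
  · rw [prod_erase_two_three', map_mul, hsk, hsk, neg_mul_neg]

/-- The criterion scalars `c′ᵢ := dᵢ · s′ᵢ` are `σ`-fixed when the Gram values are. [cite: Jacobowitz1962, §8] -/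
theorem criterion_symm_sigma_fixed (σ : K →+* K) {γ d : Fin 3 → K} (hσγ : ∀ i, σ (γ i) = (γ i)⁻¹) (hγne : ∀ i, γ i ≠ 0) (hdσ : ∀ i, σ (d i) = d i)
    (i : Fin 3) : σ (d i * ∏ j ∈ univ.erase i, (γ i - γ j) / ((1 + γ i) * (1 + γ j))) = d i * ∏ j ∈ univ.erase i, (γ i - γ j) / ((1 + γ i) * (1 + γ j)) := by
  rw [map_mul, hdσ, symmProd_one_fixed σ hσγ hγne]

/-! ## §2 (⟸) A rational good vector from ONE norm solution over the eigen-field -/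

/-- **★ O8a-∃ WITH A COMMON UNIT CONSTANT** (`δ := 1`): if `aᵢσ(aᵢ)·c′ᵢ = κ` for all `i` with `κ ∈ O^×`, then `a` is GOOD (`T(a) = κ·λ′`, `λ′ ∈ R^×` by ★ `symmFactor_mem_span_pow`∕`_units`).
[cite: Jacobowitz1962, §4] [cite: SerreLocalFields1979, Ch. V §2 Prop. 3] -/
theorem exists_good_of_norm_solutions_const {n : ℕ} (O : Subring K) (σ : K →+* K) {γ : Fin n → K} (hγ : ∀ i, γ i ∈ O)
    (hγ1u : ∀ i, ∃ y ∈ O, y * (1 + γ i) = 1) {κ : K} (hκO : κ ∈ O) (hκu : ∃ y ∈ O, y * κ = 1) (d a : Fin n → K)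
    (ha : ∀ i, a i * σ (a i) * (d i * ∏ j ∈ univ.erase i, (γ i - γ j) / ((1 + γ i) * (1 + γ j))) = κ) :
    (fun i => d i * a i * σ (a i) * ∏ j ∈ univ.erase i, (γ i - γ j)) ∈ Submodule.span O (Set.range fun j : Fin n => fun i => γ i ^ (j : ℕ)) ∧
      ∀ i, ∃ y ∈ O, y * (d i * a i * σ (a i) * ∏ j ∈ univ.erase i, (γ i - γ j)) = 1 := by
  have hγ1 : ∀ i, 1 + γ i ≠ 0 := fun i h0 => by
    obtain ⟨y, -, hy⟩ := hγ1u i; rw [h0, mul_zero] at hy; exact zero_ne_one hy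
  have hfirst : (fun i => d i * (a i * σ (a i)) * ∏ j ∈ univ.erase i, (γ i - γ j) / ((1 + γ i) * (1 + γ j) * (1 : K))) = fun _ => κ := by
    funext i
    rw [prod_cayley_mul_one]
    linear_combination ha i
  have hT : (fun i => d i * a i * σ (a i) * ∏ j ∈ univ.erase i, (γ i - γ j)) =
      (⟨κ, hκO⟩ : O) • fun i => ∏ j ∈ univ.erase i, ((1 + γ i) * (1 + γ j) * (1 : K)) := by
    rw [criterion_eq_normSymm_mul σ (one_ne_zero) hγ1 d a, hfirst]
    funext i
    simp only [Pi.mul_apply, Pi.smul_apply, Subring.smul_def, smul_eq_mul]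
  refine ⟨?_, fun i => ?_⟩
  · rw [hT]; exact Submodule.smul_mem _ _ (symmFactor_mem_span_pow O hγ hγ1u O.one_mem)
  · have h : d i * a i * σ (a i) * ∏ j ∈ univ.erase i, (γ i - γ j) = κ * ∏ j ∈ univ.erase i, ((1 + γ i) * (1 + γ j) * (1 : K)) := by
      have := congrFun hT i
      simpa only [Pi.smul_apply, Subring.smul_def, smul_eq_mul] using this
    obtain ⟨yl, hyl, hyl1⟩ := symmFactor_units O hγ hγ1u O.one_mem ⟨1, O.one_mem, one_mul 1⟩ i
    obtain ⟨yk, hyk, hyk1⟩ := hκu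
    refine ⟨yk * yl, O.mul_mem hyk hyl, ?_⟩
    rw [h]
    linear_combination (yl * ∏ j ∈ univ.erase i, ((1 + γ i) * (1 + γ j) * (1 : K))) * hyk1 + hyl1

/-- **(⟸) A RATIONAL GOOD VECTOR EXISTS AS SOON AS `bσ(b)·c′₁ = 1` IS SOLVABLE** (ramified base, unramified eigen-field).  With the ramified norm dictionaries of the module
docstring: (nE′) gives a rational `a₀` and a constant `κ ∈ {1, η₀}` with `a₀σ(a₀)c′₀ = κ`; `a₁ := b·e` with `eσ(e) = κ` (`e = 1` or the `σ`-norm witness of `η₀`), `a₂ := ι a₁` (then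
`a₂σ(a₂)c′₂ = ι κ = κ` since `c′₂ = ι c′₁`, `σι = ισ`); and ★ O8a-∃ with the constant `κ` makes `a` GOOD — the `d₀`-coordinate never obstructs.
[cite: Rogawski1990, §4.9 Lemma 4.9.3 p. 56] [cite: Jacobowitz1962, §5, §8] [cite: SerreLocalFields1979, Ch. V §3 Cor. 2] -/
theorem exists_rational_good_of_exists_norm_ramifiedBase (O : Subring K) (σ ι : K →+* K) (hσι : ∀ x, σ (ι x) = ι (σ x))
    {η₀ : K} (hη₀O : η₀ ∈ O) (hη₀u : ∃ y ∈ O, y * η₀ = 1) (hιη₀ : ι η₀ = η₀) (hη₀n : ∃ e : K, e * σ e = η₀)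
    (hnE : ∀ c : K, c ≠ 0 → σ c = c → ι c = c → ∃ a : K, ι a = a ∧ (a * σ a * c = 1 ∨ a * σ a * c = η₀))
    {γ d : Fin 3 → K} (hγO : ∀ i, γ i ∈ O) (hγ1u : ∀ i, ∃ y ∈ O, y * (1 + γ i) = 1)
    (hσγ : ∀ i, σ (γ i) = (γ i)⁻¹) (hγne : ∀ i, γ i ≠ 0) (hinj : Function.Injective γ)
    (hιγ0 : ι (γ 0) = γ 0) (hιγ1 : ι (γ 1) = γ 2) (hιγ2 : ι (γ 2) = γ 1)
    (hdσ : ∀ i, σ (d i) = d i) (hdne : ∀ i, d i ≠ 0) (hιd0 : ι (d 0) = d 0) (hιd1 : ι (d 1) = d 2)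
    (hb : ∃ b : K, b * σ b * (d 1 * ∏ j ∈ univ.erase (1 : Fin 3), (γ 1 - γ j) / ((1 + γ 1) * (1 + γ j))) = 1) :
    ∃ a : Fin 3 → K, ι (a 0) = a 0 ∧ a 2 = ι (a 1) ∧
      ((fun i => d i * a i * σ (a i) * ∏ j ∈ univ.erase i, (γ i - γ j)) ∈ Submodule.span O (Set.range fun j : Fin 3 => fun i => γ i ^ (j : ℕ)) ∧
        ∀ i, ∃ y ∈ O, y * (d i * a i * σ (a i) * ∏ j ∈ univ.erase i, (γ i - γ j)) = 1) := by
  -- the `δ := 1` criterion scalars `c′ i`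
  set c : Fin 3 → K := fun i => d i * ∏ j ∈ univ.erase i, (γ i - γ j) / ((1 + γ i) * (1 + γ j)) with hc
  have hunit_ne : ∀ {x : K}, (∃ y ∈ O, y * x = 1) → x ≠ 0 := fun ⟨y, _, hy⟩ h0 => by rw [h0, mul_zero] at hy; exact zero_ne_one hy
  have hγ1 : ∀ i, 1 + γ i ≠ 0 := fun i => hunit_ne (hγ1u i)
  -- `σ`- and `ι`-behaviour of `c′`
  have hcσ : ∀ i, σ (c i) = c i := fun i => criterion_symm_sigma_fixed σ hσγ hγne hdσ i
  have hcι0 : ι (c 0) = c 0 := by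
    have h := map_symmCriterion_zero_eq ι (γ := γ) (d := d) (δ := (1 : K)) hιγ0 hιγ1 hιγ2 hιd0 (map_one ι)
    simpa only [hc, prod_cayley_mul_one] using h
  have hcι1 : ι (c 1) = c 2 := by
    have h := map_symmCriterion_one_eq ι (γ := γ) (d := d) (δ := (1 : K)) hιγ0 hιγ1 hιγ2 hιd1 (map_one ι)
    simpa only [hc, prod_cayley_mul_one] using h
  have hcne : ∀ i, c i ≠ 0 := by
    intro i
    simp only [hc]
    refine mul_ne_zero (hdne i) (Finset.prod_ne_zero_iff.2 fun j hj => div_ne_zero (sub_ne_zero.2 fun h => ?_) ?_)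
    · exact (Finset.ne_of_mem_erase hj) (hinj h).symm
    · exact mul_ne_zero (hγ1 i) (hγ1 j)
  -- the rational coordinate and its constant `κ ∈ {1, η₀}`
  obtain ⟨a0, ha0ι, ha0⟩ := hnE (c 0) (hcne 0) (hcσ 0) hcι0
  obtain ⟨b, hb⟩ := hb
  have hb' : b * σ b * c 1 = 1 := hb
  -- the common construction, for a constant `κ` with a `σ`-norm witness `e`
  have key : ∀ κ e : K, κ ∈ O → (∃ y ∈ O, y * κ = 1) → ι κ = κ → e * σ e = κ → a0 * σ a0 * c 0 = κ →
      ∃ a : Fin 3 → K, ι (a 0) = a 0 ∧ a 2 = ι (a 1) ∧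
        ((fun i => d i * a i * σ (a i) * ∏ j ∈ univ.erase i, (γ i - γ j)) ∈ Submodule.span O (Set.range fun j : Fin 3 => fun i => γ i ^ (j : ℕ)) ∧
          ∀ i, ∃ y ∈ O, y * (d i * a i * σ (a i) * ∏ j ∈ univ.erase i, (γ i - γ j)) = 1) := by
    intro κ e hκO hκu hικ he h0
    have h1 : (b * e) * σ (b * e) * c 1 = κ := by
      rw [map_mul]
      linear_combination (e * σ e) * hb' + he
    have h2 : ι (b * e) * σ (ι (b * e)) * c 2 = κ := by
      rw [hσι, ← hcι1, ← map_mul, ← map_mul, h1, hικ]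
    refine ⟨![a0, b * e, ι (b * e)], ha0ι, rfl, ?_⟩
    have ha : ∀ i, (![a0, b * e, ι (b * e)] : Fin 3 → K) i * σ ((![a0, b * e, ι (b * e)] : Fin 3 → K) i) *
        (d i * ∏ j ∈ univ.erase i, (γ i - γ j) / ((1 + γ i) * (1 + γ j))) = κ := by
      intro i
      fin_cases i
      · exact h0
      · exact h1
      · exact h2
    exact exists_good_of_norm_solutions_const O σ hγO hγ1u hκO hκu d _ ha
  rcases ha0 with h0 | h0
  · exact key 1 1 O.one_mem ⟨1, O.one_mem, one_mul 1⟩ (map_one ι) (by rw [map_one, one_mul]) h0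
  · obtain ⟨e, he⟩ := hη₀n
    exact key η₀ e hη₀O hη₀u hιη₀ he h0

/-! ## §3 (⟹) The norm solution from a rational good vector -/

section Valued

variable [Valued K ℤᵐ⁰]

/-- **THE COMPONENTS OF AN ELEMENT OF `R = O[γ]` ARE RESIDUALLY EQUAL** when the nodes are: `|xᵢ − xₖ| < 1` for `x ∈ span_O{γ^j}` if `|γᵢ − γₖ| < 1` and `O` is integral.
[cite: SerreLocalFields1979, Ch. III §6] -/
theorem valuation_sub_lt_one_of_mem_span_pow {n : ℕ} (O : Subring K) (hO : ∀ x ∈ O, Valued.v x ≤ 1) {γ : Fin n → K} (hγO : ∀ i, γ i ∈ O)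
    (hγc : ∀ i k, Valued.v (γ i - γ k) < 1) {x : Fin n → K} (hx : x ∈ Submodule.span O (Set.range fun j : Fin n => fun i => γ i ^ (j : ℕ)))
    (i k : Fin n) : Valued.v (x i - x k) < 1 := by
  have hpow : ∀ m : ℕ, Valued.v (γ i ^ m - γ k ^ m) < 1 := by
    intro m
    induction m with
    | zero => simp
    | succ m ih =>
      have h : γ i ^ (m + 1) - γ k ^ (m + 1) = γ i * (γ i ^ m - γ k ^ m) + (γ i - γ k) * γ k ^ m := by ring
      rw [h]
      refine lt_of_le_of_lt (Valuation.map_add _ _ _) (max_lt ?_ ?_)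
      · rw [map_mul]
        calc Valued.v (γ i) * Valued.v (γ i ^ m - γ k ^ m) ≤ 1 * Valued.v (γ i ^ m - γ k ^ m) := mul_le_mul_left (hO _ (hγO i)) _
          _ < 1 := by rw [one_mul]; exact ih
      · rw [map_mul, map_pow]
        calc Valued.v (γ i - γ k) * Valued.v (γ k) ^ m ≤ Valued.v (γ i - γ k) * 1 := mul_le_mul_right (pow_le_one' (hO _ (hγO k)) m) _
          _ < 1 := by rw [mul_one]; exact hγc i k
  refine Submodule.span_induction (p := fun x _ => Valued.v (x i - x k) < 1) ?_ ?_ ?_ ?_ hx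
  · rintro x ⟨j, rfl⟩; exact hpow j
  · simp
  · intro x y _ _ hx hy
    have h : (x + y) i - (x + y) k = (x i - x k) + (y i - y k) := by simp only [Pi.add_apply]; ring
    rw [h]
    exact lt_of_le_of_lt (Valuation.map_add _ _ _) (max_lt hx hy)
  · intro r x _ hx
    have h : (r • x) i - (r • x) k = (r : K) * (x i - x k) := by rw [Pi.smul_apply, Pi.smul_apply, Subring.smul_def, Subring.smul_def, smul_eq_mul, smul_eq_mul, mul_sub]
    rw [h, map_mul]
    calc Valued.v (r : K) * Valued.v (x i - x k) ≤ 1 * Valued.v (x i - x k) := mul_le_mul_left (hO _ r.2) _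
      _ < 1 := by rw [one_mul]; exact hx

/-- The `δ := 1` symmetrisation factors `λ′ᵢ = ∏_{j≠i}(1+γᵢ)(1+γⱼ)·1` at `i = 0` and `i = 1` are residually equal when `γ₀ ≡ γ₁`: `|λ′₁ − λ′₀| < 1`. [cite: SerreLocalFields1979, Ch. III §6] -/
theorem valuation_symmFactor_sub_lt_one (O : Subring K) (hO : ∀ x ∈ O, Valued.v x ≤ 1) {γ : Fin 3 → K} (hγO : ∀ i, γ i ∈ O)
    (h01 : Valued.v (γ 0 - γ 1) < 1) :
    Valued.v (∏ j ∈ univ.erase (1 : Fin 3), ((1 + γ 1) * (1 + γ j) * (1 : K)) - ∏ j ∈ univ.erase (0 : Fin 3), ((1 + γ 0) * (1 + γ j) * (1 : K))) < 1 := by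
  rw [prod_erase_one_three', prod_erase_zero_three']
  have h : (1 + γ 1) * (1 + γ 0) * 1 * ((1 + γ 1) * (1 + γ 2) * 1) - (1 + γ 0) * (1 + γ 1) * 1 * ((1 + γ 0) * (1 + γ 2) * 1) =
      -((1 + γ 0) * (1 + γ 1) * (1 + γ 2)) * (γ 0 - γ 1) := by ring
  rw [h, map_mul, Valuation.map_neg]
  have hO1 : ∀ i, Valued.v (1 + γ i) ≤ 1 := fun i => hO _ (O.add_mem O.one_mem (hγO i))
  have hP : Valued.v ((1 + γ 0) * (1 + γ 1) * (1 + γ 2)) ≤ 1 := by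
    rw [map_mul, map_mul]
    exact mul_le_one' (mul_le_one' (hO1 0) (hO1 1)) (hO1 2)
  calc Valued.v ((1 + γ 0) * (1 + γ 1) * (1 + γ 2)) * Valued.v (γ 0 - γ 1) ≤ 1 * Valued.v (γ 0 - γ 1) := mul_le_mul_left hP _
    _ < 1 := by rw [one_mul]; exact h01

/-- **(⟹) A RATIONAL GOOD VECTOR SOLVES THE EIGEN-FIELD NORM EQUATION.**  If `a` is GOOD with `ι a₀ = a₀` then the scalars `vᵢ := aᵢσ(aᵢ)c′ᵢ` are units of `O` (★ `isUnit_normSymm_of_criterion`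
at `δ := 1`) with `v₁ ≡ v₀ (mod 𝔪)` (`T(a) ∈ R` has residually equal components — all nodes are residually equal — and `T(a)ᵢ = vᵢ·λ′ᵢ` with `λ′₁ ≡ λ′₀`), and `v₀` is `σ`- and `ι`-fixed;
so (nK′) gives `eσ(e) = v₁` and `b := a₁∕e` solves `bσ(b)c′₁ = 1`. [cite: Rogawski1990, §4.9 Lemma 4.9.3 p. 56] [cite: Jacobowitz1962, §5, §8] [cite: SerreLocalFields1979, Ch. V §2 Prop. 3, §3 Cor. 2] -/
theorem exists_norm_of_rational_good_ramifiedBase (O : Subring K) (hO : ∀ x ∈ O, Valued.v x ≤ 1) (σ ι : K →+* K) (hσσ : ∀ x, σ (σ x) = x)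
    (hσι : ∀ x, σ (ι x) = ι (σ x))
    (hnK : ∀ v ∈ O, (∃ y ∈ O, y * v = 1) → σ v = v → (∃ f : K, σ f = f ∧ ι f = f ∧ Valued.v (v - f) < 1) → ∃ e : K, e * σ e = v)
    {γ d : Fin 3 → K} (hγO : ∀ i, γ i ∈ O) (hγ1u : ∀ i, ∃ y ∈ O, y * (1 + γ i) = 1)
    (hσγ : ∀ i, σ (γ i) = (γ i)⁻¹) (hγne : ∀ i, γ i ≠ 0) (hγc : ∀ i k, Valued.v (γ i - γ k) < 1)
    (hιγ0 : ι (γ 0) = γ 0) (hιγ1 : ι (γ 1) = γ 2) (hιγ2 : ι (γ 2) = γ 1)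
    (hdσ : ∀ i, σ (d i) = d i) (hιd0 : ι (d 0) = d 0)
    {a : Fin 3 → K} (ha0 : ι (a 0) = a 0)
    (hgood : ((fun i => d i * a i * σ (a i) * ∏ j ∈ univ.erase i, (γ i - γ j)) ∈ Submodule.span O (Set.range fun j : Fin 3 => fun i => γ i ^ (j : ℕ)) ∧
        ∀ i, ∃ y ∈ O, y * (d i * a i * σ (a i) * ∏ j ∈ univ.erase i, (γ i - γ j)) = 1)) :
    ∃ b : K, b * σ b * (d 1 * ∏ j ∈ univ.erase (1 : Fin 3), (γ 1 - γ j) / ((1 + γ 1) * (1 + γ j))) = 1 := by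
  set c : Fin 3 → K := fun i => d i * ∏ j ∈ univ.erase i, (γ i - γ j) / ((1 + γ i) * (1 + γ j)) with hc
  have hunit_ne : ∀ {x : K}, (∃ y ∈ O, y * x = 1) → x ≠ 0 := fun ⟨y, _, hy⟩ h0 => by rw [h0, mul_zero] at hy; exact zero_ne_one hy
  have hγ1 : ∀ i, 1 + γ i ≠ 0 := fun i => hunit_ne (hγ1u i)
  -- valuations of units of `O`
  have hvunit : ∀ {x : K}, x ∈ O → (∃ y ∈ O, y * x = 1) → Valued.v x = 1 := by
    rintro x hxO ⟨y, hyO, hy⟩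
    apply le_antisymm (hO x hxO)
    by_contra hlt
    rw [not_le] at hlt
    have h1 : Valued.v y * Valued.v x = 1 := by rw [← map_mul, hy, map_one]
    have : Valued.v y * Valued.v x < 1 :=
      calc Valued.v y * Valued.v x ≤ 1 * Valued.v x := mul_le_mul_left (hO y hyO) _
        _ < 1 := by rw [one_mul]; exact hlt
    rw [h1] at this
    exact lt_irrefl _ this
  -- the criterion vector lies in `O` componentwise
  have hTO : ∀ i, d i * a i * σ (a i) * ∏ j ∈ univ.erase i, (γ i - γ j) ∈ O := fun i => apply_mem_of_mem_span_pow O hγO hgood.1 i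
  -- `vᵢ := aᵢ σ(aᵢ) c′ᵢ` are units of `O` (★ O8a converse at `δ := 1`)
  have hv : ∀ i, a i * σ (a i) * c i ∈ O ∧ ∃ y ∈ O, y * (a i * σ (a i) * c i) = 1 := by
    intro i
    have h := isUnit_normSymm_of_criterion O σ hγO hγ1u O.one_mem ⟨1, O.one_mem, one_mul 1⟩ d a hTO hgood.2 i
    simpa only [hc, prod_cayley_mul_one] using h
  -- `T(a)ᵢ = vᵢ · λ′ᵢ`
  have hT : ∀ i, d i * a i * σ (a i) * ∏ j ∈ univ.erase i, (γ i - γ j) = (a i * σ (a i) * c i) * ∏ j ∈ univ.erase i, ((1 + γ i) * (1 + γ j) * (1 : K)) := by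
    intro i
    have h := congrFun (criterion_eq_normSymm_mul σ (one_ne_zero) hγ1 d a) i
    simp only [Pi.mul_apply] at h
    rw [prod_cayley_mul_one] at h
    rw [h]
    simp only [hc]
    ring
  -- `v₁ ≡ v₀ (mod 𝔪)`
  have hLO : ∀ i, ∏ j ∈ univ.erase i, ((1 + γ i) * (1 + γ j) * (1 : K)) ∈ O := fun i =>
    Subring.prod_mem _ fun j _ => O.mul_mem (O.mul_mem (O.add_mem O.one_mem (hγO i)) (O.add_mem O.one_mem (hγO j))) O.one_mem
  have hLv : ∀ i, Valued.v (∏ j ∈ univ.erase i, ((1 + γ i) * (1 + γ j) * (1 : K))) = 1 := fun i =>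
    hvunit (hLO i) (symmFactor_units O hγO hγ1u O.one_mem ⟨1, O.one_mem, one_mul 1⟩ i)
  have hTT : Valued.v ((d 1 * a 1 * σ (a 1) * ∏ j ∈ univ.erase (1 : Fin 3), (γ 1 - γ j)) -
      (d 0 * a 0 * σ (a 0) * ∏ j ∈ univ.erase (0 : Fin 3), (γ 0 - γ j))) < 1 :=
    valuation_sub_lt_one_of_mem_span_pow O hO hγO hγc hgood.1 1 0
  have hv10 : Valued.v (a 1 * σ (a 1) * c 1 - a 0 * σ (a 0) * c 0) < 1 := by
    -- `v₁ λ′₁ − v₀ λ′₀ = T₁ − T₀`, and `v₁ − v₀ = ((T₁ − T₀) − v₀ (λ′₁ − λ′₀)) ∕ λ′₁`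
    have hT1 := hT 1
    have hT0 := hT 0
    have hL1v := hLv 1
    have hL10 := valuation_symmFactor_sub_lt_one O hO hγO (hγc 0 1)
    set L0 := ∏ j ∈ univ.erase (0 : Fin 3), ((1 + γ 0) * (1 + γ j) * (1 : K)) with hL0
    set L1 := ∏ j ∈ univ.erase (1 : Fin 3), ((1 + γ 1) * (1 + γ j) * (1 : K)) with hL1
    have hL1ne : L1 ≠ 0 := fun h0 => by rw [h0, map_zero] at hL1v; exact zero_ne_one hL1v
    have heq : a 1 * σ (a 1) * c 1 - a 0 * σ (a 0) * c 0 =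
        (((a 1 * σ (a 1) * c 1) * L1 - (a 0 * σ (a 0) * c 0) * L0) - (a 0 * σ (a 0) * c 0) * (L1 - L0)) / L1 := by
      field_simp
      ring
    rw [heq, map_div₀, hL1v, div_one]
    refine lt_of_le_of_lt (Valuation.map_sub _ _ _) (max_lt ?_ ?_)
    · rw [← hT1, ← hT0]; exact hTT
    · rw [map_mul, hvunit (hv 0).1 (hv 0).2, one_mul]
      exact hL10
  -- `v₀` is `σ`- and `ι`-fixed
  have hcσ : ∀ i, σ (c i) = c i := fun i => criterion_symm_sigma_fixed σ hσγ hγne hdσ i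
  have hcι0 : ι (c 0) = c 0 := by
    have h := map_symmCriterion_zero_eq ι (γ := γ) (d := d) (δ := (1 : K)) hιγ0 hιγ1 hιγ2 hιd0 (map_one ι)
    simpa only [hc, prod_cayley_mul_one] using h
  have hv0σ : σ (a 0 * σ (a 0) * c 0) = a 0 * σ (a 0) * c 0 := by rw [map_mul, map_mul, hσσ, hcσ 0]; ring
  have hv0ι : ι (a 0 * σ (a 0) * c 0) = a 0 * σ (a 0) * c 0 := by rw [map_mul, map_mul, ← hσι, ha0, hcι0]
  -- (nK′): `v₁` is a `σ`-norm
  have hv1σ : σ (a 1 * σ (a 1) * c 1) = a 1 * σ (a 1) * c 1 := by rw [map_mul, map_mul, hσσ, hcσ 1]; ring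
  obtain ⟨e, he⟩ := hnK _ (hv 1).1 (hv 1).2 hv1σ ⟨a 0 * σ (a 0) * c 0, hv0σ, hv0ι, hv10⟩
  have hene : e ≠ 0 := fun h0 => by
    have hne := hunit_ne (hv 1).2
    rw [h0, zero_mul] at he
    exact hne he.symm
  have hσe : σ e ≠ 0 := fun h0 => by
    have : σ (σ e) = σ 0 := by rw [h0]
    rw [hσσ, map_zero] at this
    exact hene this
  refine ⟨a 1 / e, ?_⟩
  have h : a 1 / e * σ (a 1 / e) * c 1 = (a 1 * σ (a 1) * c 1) / (e * σ e) := by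
    rw [map_div₀]
    field_simp
  rw [h, ← he]
  exact div_self (mul_ne_zero hene hσe)

/-! ## §4 The equivalence -/

/-- **«[T2-b]-ram CORE» — AT A TAME-RAMIFIED BASE THE GOOD CLASS IS CUT OUT BY ONE EIGEN-FIELD NORM EQUATION.**  For a symmetric type-(2) eigen-datum `(γ, d)` over the UNRAMIFIED
eigen-field `K = M` (three norm-one, residually equal nodes; `σ`-fixed Gram values), with the CM involution `σ`, the rationality involution `ι`, and the ramified norm dictionaries `η₀`,
(nE′), (nK′) of the module docstring: a RATIONAL GOOD vector exists **iff** `∃ b, bσ(b)·c′₁ = 1`, `c′₁ = d₁·∏_{j≠1}(γ₁ − γⱼ)∕((1+γ₁)(1+γⱼ))`.  Consequently (★ [T2-a]-type torsor count) the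
free-row count is `[C : R^×]` on the class where `c′₁ ∈ N_{M∕M^σ}(M^×)` and `0` on the other; the certified reading of that class on the rational Gram value is
`χ_{E∕F}(d₀·det h) = Leg(res(χ₂(u)∕(−ϖ_F)^{n∕2}))`, i.e. `κ_good = χ(det h)·μ_w((u−λ)(u−ιλ))` (memo CERT-T2b-ram; one-place sequel).
[cite: Rogawski1990, §4.9 Lemma 4.9.3 p. 56, Prop. 4.9.1 p. 55] [cite: Jacobowitz1962, §5, §7 Thm. 7.1, §8] [cite: SerreLocalFields1979, Ch. V §2 Prop. 3, §3 Cor. 2] [cite: LanglandsShelstad1987, §1.3–1.4] -/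
theorem exists_rational_good_iff_exists_norm_ramifiedBase (O : Subring K) (hO : ∀ x ∈ O, Valued.v x ≤ 1) (σ ι : K →+* K) (hσσ : ∀ x, σ (σ x) = x)
    (hσι : ∀ x, σ (ι x) = ι (σ x))
    {η₀ : K} (hη₀O : η₀ ∈ O) (hη₀u : ∃ y ∈ O, y * η₀ = 1) (hιη₀ : ι η₀ = η₀) (hη₀n : ∃ e : K, e * σ e = η₀)
    (hnE : ∀ c : K, c ≠ 0 → σ c = c → ι c = c → ∃ a : K, ι a = a ∧ (a * σ a * c = 1 ∨ a * σ a * c = η₀))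
    (hnK : ∀ v ∈ O, (∃ y ∈ O, y * v = 1) → σ v = v → (∃ f : K, σ f = f ∧ ι f = f ∧ Valued.v (v - f) < 1) → ∃ e : K, e * σ e = v)
    {γ d : Fin 3 → K} (hγO : ∀ i, γ i ∈ O) (hγ1u : ∀ i, ∃ y ∈ O, y * (1 + γ i) = 1)
    (hσγ : ∀ i, σ (γ i) = (γ i)⁻¹) (hγne : ∀ i, γ i ≠ 0) (hinj : Function.Injective γ) (hγc : ∀ i k, Valued.v (γ i - γ k) < 1)
    (hιγ0 : ι (γ 0) = γ 0) (hιγ1 : ι (γ 1) = γ 2) (hιγ2 : ι (γ 2) = γ 1)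
    (hdσ : ∀ i, σ (d i) = d i) (hdne : ∀ i, d i ≠ 0) (hιd0 : ι (d 0) = d 0) (hιd1 : ι (d 1) = d 2) :
    (∃ a : Fin 3 → K, ι (a 0) = a 0 ∧ a 2 = ι (a 1) ∧
      ((fun i => d i * a i * σ (a i) * ∏ j ∈ univ.erase i, (γ i - γ j)) ∈ Submodule.span O (Set.range fun j : Fin 3 => fun i => γ i ^ (j : ℕ)) ∧
        ∀ i, ∃ y ∈ O, y * (d i * a i * σ (a i) * ∏ j ∈ univ.erase i, (γ i - γ j)) = 1)) ↔
      ∃ b : K, b * σ b * (d 1 * ∏ j ∈ univ.erase (1 : Fin 3), (γ 1 - γ j) / ((1 + γ 1) * (1 + γ j))) = 1 := by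
  constructor
  · rintro ⟨a, ha0, -, hgood⟩
    exact exists_norm_of_rational_good_ramifiedBase O hO σ ι hσσ hσι hnK hγO hγ1u hσγ hγne hγc hιγ0 hιγ1 hιγ2 hdσ hιd0 ha0 hgood
  · intro hb
    exact exists_rational_good_of_exists_norm_ramifiedBase O σ ι hσι hη₀O hη₀u hιη₀ hη₀n hnE hγO hγ1u hσγ hγne hinj hιγ0 hιγ1 hιγ2 hdσ hdne hιd0 hιd1 hb

end Valued

end Literature.NumberTheory.Automorphic.SymmetricEigenframe
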